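import Summits.RiemannHypothesis.RiemannHypothesis.Theorems.Splittings.LinearRayWideWindow
import Summits.RiemannHypothesis.RiemannHypothesis.Theorems.LaplaceLoophole.Negative.LaplaceLoopholeWideWindow
import HarnessLib

/-!
# RiemannHypothesis / Splittings — kernel sign cells for the wide-window residue `Re Φ_ℂ(iy)` ACROSS the
residue zero `a₀ = 0.3194150268…` (negative-side support for the linear-factor ray of
`Literature/Barriers/RiemannHypothesis/NewmanConjecture.lean`, splitting-search cell `rh-split`, seat (dbn, neg) g3)

The tree's compiled checker `UniversalFactor.PhiICert.cellsCheck` (`LaplaceLoopholeThetaCells.lean`) decides the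
sign of `Re Φ_ℂ(iy) = Re Σ_{m≥1} s_m(y)` on whole cells, for BOTH signs (`cellsCheck_sound`); the tree compiles
only the positive window `[0, 0.3188]` (`re_tsum_pos_wide`), because above `a₀` the EVEN ray is closed by one-point
Laguerre certificates instead.  The LINEAR ray `linearFactorH a = (1 − D/a)⁻¹H_0` has no such certificates; its
wide window `0 < |a| < π/8` is decided by the SIGN of the residue `∫₀^∞ H_0 cosh(a·) = (π/2)Φ_ℂ(ia)` alone
(`Theorems/Splittings/LinearRayWideWindow.lean`, `not_hasOnlyRealZeros_linearFactorH_of_coshIntegral_ne_zero`).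
This file compiles the missing cells (all `decide +kernel`, fixed-point scale `2⁴⁸`, NO `native_decide`):

* `cellsCheck_posCellsExt` — 5 more positive cells `[0.3188, 0.31935]` (12 terms);
* `cellsCheck_negCellsA/B/C/D` — 34 negative cells `[0.31945, 0.3700]` (12 / 16 / 24 / 30 terms; the cells
  shrink towards `a₀`, where `Re Φ_ℂ(iy)` vanishes to first order, and towards `π/8`, where the theta damping
  `e^{−πm² cos 4y}` disappears and the Lipschitz constant of the checker blows up — `0.37` is where 30 terms and
  width `2·10⁻⁴` stop paying; `(0.37, π/8)` is left open);
* `re_tsum_pos_ext` (`0 ≤ y ≤ 0.31935`), `re_tsum_neg_mid` (`0.31945 ≤ y ≤ 0.37`) — the signs;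
* `coshIntegral_ne_zero_of_abs_le_ext` (`|a| ≤ 0.31935`), `coshIntegral_ne_zero_of_mem_mid`
  (`0.31945 ≤ |a| ≤ 0.37`) — the residue of the wide window is non-zero there
  (`UniversalFactor.coshIntegral_ne_zero_of_re_tsum_ne_zero`).

* `LinearRayWideWindow.not_hasOnlyRealZeros_linearFactorH_of_abs_le_ext` / `_of_mem_mid` /
  `exists_nonreal_zero_linearFactorH_of_abs_le_of_gap` — the LINEAR RAY refuted unconditionally for every
  `a ≠ 0` with `|a| ≤ 0.37` outside the gap (through `not_hasOnlyRealZeros_linearFactorH_of_coshIntegral_ne_zero`).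

The uncertified gap `(0.31935, 0.31945) ∋ a₀` has width `10⁻⁴`.  Zero `def`s; literal cell lists.
Filed by rh-split-typer-1 g2 (lead g2 23:41Z «PART 2 = typer CLAIM-able, P2»; CLAIM 23:4xZ) verbatim from dbn-neg g3's
`HOME/rh-split-dbn-neg/LinearRayResidueCells.lean` (sha16 cf31154d3414b71d); typer replay: farm rc 0, 0 warnings, 0 sorry (≈100 s of
`decide +kernel`), `#print axioms exists_nonreal_zero_linearFactorH_of_abs_le_of_gap` = [propext, Classical.choice, Quot.sound].
HONEST LABEL: refutations of an RH-STRENGTHENING conjunct; nothing here bears on the truth of RH.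
-/

noncomputable section

set_option linter.dupNamespace false

namespace Summit.RiemannHypothesis.RiemannHypothesis.Theorems.Splittings.ResidueSignCells

open MeasureTheory Set Complex Real
open Literature.NumberTheory.LFunctions
open Summit.RiemannHypothesis.RiemannHypothesis.Theorems.UniversalFactor.PhiICert

/-! ## Compiled cells -/

/-- **5 more positive cells**: `Re Φ_ℂ(iy) > 0` certified on `[0.3188, 0.31935]` (12 terms). [folklore] -/
theorem cellsCheck_posCellsExt :
    cellsCheck true 12 31880 [31900, 31910, 31920, 31930, 31935] = true := by
  decide +kernel

/-- **Negative cells, chain A** (12 terms): `[0.31945, 0.34]`. [folklore] -/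
theorem cellsCheck_negCellsA :
    cellsCheck false 12 31945 [31948, 31953, 31960, 31970, 31980, 32010, 32060, 32130, 32230, 32430, 32730,
      33030, 33530, 34000] = true := by
  decide +kernel

/-- **Negative cells, chain B** (16 terms): `[0.34, 0.355]`. [folklore] -/
theorem cellsCheck_negCellsB : cellsCheck false 16 34000 [34500, 35000, 35300, 35500] = true := by
  decide +kernel

/-- **Negative cells, chain C** (24 terms): `[0.355, 0.365]`. [folklore] -/
theorem cellsCheck_negCellsC :
    cellsCheck false 24 35500 [35800, 36000, 36200, 36350, 36450, 36500] = true := by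
  decide +kernel

/-- **Negative cells, chain D** (30 terms): `[0.365, 0.37]`. [folklore] -/
theorem cellsCheck_negCellsD :
    cellsCheck false 30 36500 [36600, 36670, 36740, 36790, 36840, 36890, 36920, 36950, 36980, 37000] = true := by
  decide +kernel

/-! ## Signs of `Re Φ_ℂ(iy)` -/

/-- Cast bookkeeping for the fixed-point grid `k/100000`. -/
private theorem kd_div (k : ℕ) : ((k : ℕ) : ℝ) / KD = (k : ℝ) / 100000 := by norm_num [KD]

/-- **`Re Φ_ℂ(iy) > 0` for `0 ≤ y ≤ 0.31935`** (the tree's window `[0, 0.3188]` + 5 cells). [folklore] -/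
theorem re_tsum_pos_ext {y : ℝ} (h0 : 0 ≤ y) (h1 : y ≤ 31935 / 100000) :
    0 < (∑' n : ℕ, term (n + 1) y).re := by
  rcases le_or_gt y (3188 / 10000) with h | h
  · exact re_tsum_pos_wide h0 h
  · refine re_tsum_pos_of_cellsCheck cellsCheck_posCellsExt (kₙ := 31935) rfl y ⟨?_, ?_⟩
    · rw [kd_div]; push_cast; linarith
    · rw [kd_div]; push_cast; linarith

/-- **`Re Φ_ℂ(iy) < 0` for `0.31945 ≤ y ≤ 0.37`** (34 cells in four chains). [folklore] -/
theorem re_tsum_neg_mid {y : ℝ} (h0 : 31945 / 100000 ≤ y) (h1 : y ≤ 37 / 100) :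
    (∑' n : ℕ, term (n + 1) y).re < 0 := by
  rcases le_or_gt y (34000 / 100000) with hA | hA
  · refine re_tsum_neg_of_cellsCheck cellsCheck_negCellsA (kₙ := 34000) rfl y ⟨?_, ?_⟩
    · rw [kd_div]; push_cast; linarith
    · rw [kd_div]; push_cast; linarith
  rcases le_or_gt y (35500 / 100000) with hB | hB
  · refine re_tsum_neg_of_cellsCheck cellsCheck_negCellsB (kₙ := 35500) rfl y ⟨?_, ?_⟩
    · rw [kd_div]; push_cast; linarith
    · rw [kd_div]; push_cast; linarith
  rcases le_or_gt y (36500 / 100000) with hC | hC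
  · refine re_tsum_neg_of_cellsCheck cellsCheck_negCellsC (kₙ := 36500) rfl y ⟨?_, ?_⟩
    · rw [kd_div]; push_cast; linarith
    · rw [kd_div]; push_cast; linarith
  · refine re_tsum_neg_of_cellsCheck cellsCheck_negCellsD (kₙ := 37000) rfl y ⟨?_, ?_⟩
    · rw [kd_div]; push_cast; linarith
    · rw [kd_div]; push_cast; linarith

/-! ## The wide-window residue `∫₀^∞ H_0 cosh(a·)` is non-zero on the two windows -/

/-- `0.37 < π/8`. -/
private theorem pi_div_eight_gt : (37 : ℝ) / 100 < Real.pi / 8 := by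
  have := Real.pi_gt_three
  linarith

/-- **Residue `≠ 0` for `|a| ≤ 0.31935`.** [folklore] -/
theorem coshIntegral_ne_zero_of_abs_le_ext {a : ℝ} (h1 : |a| ≤ 31935 / 100000) :
    (∫ x in Ioi (0:ℝ), deBruijnH 0 (x : ℂ) * (Real.cosh (a * x) : ℂ)) ≠ 0 := by
  have hlt : |(|a|)| < Real.pi / 8 := by
    rw [abs_abs]; have := pi_div_eight_gt; linarith
  have hcert := UniversalFactor.coshIntegral_ne_zero_of_re_tsum_ne_zero hlt
    (re_tsum_pos_ext (abs_nonneg a) h1).ne'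
  rcases abs_choice a with h | h
  · rwa [h] at hcert
  · simpa only [h, neg_mul, Real.cosh_neg] using hcert

/-- **Residue `≠ 0` for `0.31945 ≤ |a| ≤ 0.37`** (it is negative there). [folklore] -/
theorem coshIntegral_ne_zero_of_mem_mid {a : ℝ} (h0 : 31945 / 100000 ≤ |a|) (h1 : |a| ≤ 37 / 100) :
    (∫ x in Ioi (0:ℝ), deBruijnH 0 (x : ℂ) * (Real.cosh (a * x) : ℂ)) ≠ 0 := by
  have hlt : |(|a|)| < Real.pi / 8 := by
    rw [abs_abs]; exact lt_of_le_of_lt h1 pi_div_eight_gt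
  have hcert := UniversalFactor.coshIntegral_ne_zero_of_re_tsum_ne_zero hlt (re_tsum_neg_mid h0 h1).ne
  rcases abs_choice a with h | h
  · rwa [h] at hcert
  · simpa only [h, neg_mul, Real.cosh_neg] using hcert

end Summit.RiemannHypothesis.RiemannHypothesis.Theorems.Splittings.ResidueSignCells

/-! ## The linear-factor ray: unconditional windows on both sides of the residue zero `a₀` -/

namespace Summit.RiemannHypothesis.RiemannHypothesis.Theorems.Splittings.LinearRayWideWindow

open Complex MeasureTheory Set
open Literature.NumberTheory.LFunctions
open Literature.Barriers.RiemannHypothesis (linearFactorH)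
open Summit.RiemannHypothesis.RiemannHypothesis.Theorems.Splittings.ResidueSignCells

/-- `0.37 < π/8` (copy in the second namespace). -/
private theorem pi_div_eight_gt' : (37 : ℝ) / 100 < Real.pi / 8 := by
  have := Real.pi_gt_three
  linarith

/-- **Unconditional lower window, extended**: for `0 < |a| ≤ 0.31935`, `linearFactorH a` has a non-real
zero (residue `> 0`: the tree's 18 cells + `cellsCheck_posCellsExt`). [folklore] -/
theorem not_hasOnlyRealZeros_linearFactorH_of_abs_le_ext {a : ℝ} (ha : a ≠ 0)
    (h1 : |a| ≤ 31935 / 100000) : ¬ HasOnlyRealZeros (linearFactorH a) :=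
  not_hasOnlyRealZeros_linearFactorH_of_coshIntegral_ne_zero ha
    (lt_of_le_of_lt h1 (by have := pi_div_eight_gt'; linarith))
    (coshIntegral_ne_zero_of_abs_le_ext h1)

/-- **Unconditional upper window**: for `0.31945 ≤ |a| ≤ 0.37`, `linearFactorH a` has a non-real zero
(residue `< 0`: 34 negative cells). [folklore] -/
theorem not_hasOnlyRealZeros_linearFactorH_of_mem_mid {a : ℝ} (h0 : 31945 / 100000 ≤ |a|)
    (h1 : |a| ≤ 37 / 100) : ¬ HasOnlyRealZeros (linearFactorH a) :=
  not_hasOnlyRealZeros_linearFactorH_of_coshIntegral_ne_zero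
    (abs_pos.1 (lt_of_lt_of_le (by norm_num) h0)) (lt_of_le_of_lt h1 pi_div_eight_gt')
    (coshIntegral_ne_zero_of_mem_mid h0 h1)

/-- **Summary**: every `a ≠ 0` with `|a| ≤ 0.37` outside the gap `(0.31935, 0.31945) ∋ ±a₀` gives a
non-real zero of `linearFactorH a`. [folklore] -/
theorem exists_nonreal_zero_linearFactorH_of_abs_le_of_gap {a : ℝ} (ha : a ≠ 0) (h1 : |a| ≤ 37 / 100)
    (hgap : |a| ≤ 31935 / 100000 ∨ 31945 / 100000 ≤ |a|) :
    ∃ z : ℂ, linearFactorH a z = 0 ∧ z.im ≠ 0 := by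
  have h : ¬ HasOnlyRealZeros (linearFactorH a) := by
    rcases hgap with h | h
    · exact not_hasOnlyRealZeros_linearFactorH_of_abs_le_ext ha h
    · exact not_hasOnlyRealZeros_linearFactorH_of_mem_mid h h1
  unfold HasOnlyRealZeros at h
  push Not at h
  exact h

/-- The splitting bookkeeping on the enlarged window: conjunct FALSE, bridge TRUE. [folklore] -/
theorem linearRay_splitting_vacuous_of_abs_le_of_gap {a : ℝ} (ha : a ≠ 0) (h1 : |a| ≤ 37 / 100)
    (hgap : |a| ≤ 31935 / 100000 ∨ 31945 / 100000 ≤ |a|) :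
    ¬ HasOnlyRealZeros (linearFactorH a) ∧
      (HasOnlyRealZeros (linearFactorH a) → Summit.RiemannHypothesis) := by
  refine ⟨?_, LinearRayTwoPoint.riemannHypothesis_of_linearRay' ha⟩
  rcases hgap with h | h
  · exact not_hasOnlyRealZeros_linearFactorH_of_abs_le_ext ha h
  · exact not_hasOnlyRealZeros_linearFactorH_of_mem_mid h h1

end Summit.RiemannHypothesis.RiemannHypothesis.Theorems.Splittings.LinearRayWideWindow

end
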